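import Summits.HodgeConjecture.HodgeConjecture.Theses.CurveNetMordellWeil
import Literature.AlgebraicGeometry.HodgeTheory.HodgeClassesCupPairing
import Literature.AlgebraicGeometry.HodgeTheory.ComplexGysinHodgeType
import Literature.AlgebraicGeometry.HodgeTheory.ComplexGysinRational
import Literature.AlgebraicGeometry.HodgeTheory.RationalClassesRingChange
import Literature.AlgebraicGeometry.HodgeTheory.RationalClassesIndependent
import Literature.AlgebraicGeometry.HodgeTheory.HodgeFiltrationModelsReductionProofs
import Literature.AlgebraicGeometry.HodgeTheory.ComplexConjugationHolds
import Literature.AlgebraicGeometry.HodgeTheory.HodgeTypePullback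
import Literature.AlgebraicGeometry.HodgeTheory.HodgeTypeConjugation
import Literature.AlgebraicGeometry.HodgeTheory.GysinKernel
import Literature.AlgebraicGeometry.HodgeTheory.GysinKernelProofs
import Literature.AlgebraicGeometry.HodgeTheory.GysinBaseChangeOfKunneth
import Literature.AlgebraicGeometry.HodgeTheory.CrossProductTopClass
import Literature.AlgebraicGeometry.HodgeTheory.HardLefschetzThreefold
import Literature.AlgebraicGeometry.HodgeTheory.GlobalInvariantCyclesProofs
import Literature.AlgebraicGeometry.Motives.ComplexPointsOrientation
import Literature.AlgebraicTopology.SingularHomology.GysinMapSupportProofs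
import Literature.AlgebraicTopology.SingularHomology.ExcisionMayerVietorisProofs
import Literature.Barriers.HodgeConjecture.GeneralizedHodgeTrivialReasonsParity
import Literature.NumberTheory.Transcendental.DeRhamTheoremMultiplicative
import Literature.AlgebraicTopology.SingularHomology.GysinTransposition

/-!
# Crux `VerticalSupportFourfolds` (stmt-HodgeConjecture-2784) — line `Sketch`: skeleton

Line lead's reshaped skeleton of the line `Sketch` (idea card `vertical-detection-contact-locus`,
ideator's typed statements `Sketch.lean`: `VerticalDetection`, `ThreefoldDivisorDetection`,
`DetectionTransfer`, …). The composition `VerticalSupportFourfolds_of` is the TRANSFER of the card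
(C⁺ = vertical detection ⇒ crux); the registered stubs are:

* `stub_facts` — LITERATURE DEBT: the named fact `hodgeClasses_cupPairing_nondegenerate 3 W` for all
  smooth projective threefolds `W` (BFNP (6.1); reduced in the tree to the Kähler package
  `hardLefschetz_hodgeRiemann 3 W`). Its slice `(k, l) = (2, 1)` — the card's
  `ThreefoldDivisorDetection`, the former stub `stub_threefoldPairing` (worker: `stub-blocked` on the
  fact) — is the proved one-liner `threefoldPairing_of_facts`.
* `stub_verticalDetection` — C⁺ (the card's `VerticalDetection`): on a smooth projective fourfold
  with a surjection `pr` onto `ℙ³`, a rational `(2,2)`-class killed by every resolved vertical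
  threefold `g : W → X` (`pr ∘ g` not dominant) is zero. This is the open heart of the line
  (Hodge-conjecture-hard: it is equivalent to the crux, see the line card).
* `stub_transferConverse` — the converse transfer crux ⇒ C⁺ modulo Deligne Hodge III 8.2.8 + BFNP (6.1)
  on fourfolds (taken by the lead; LANDED p106042 as `Theorems.stub_transferConverse`; certifies C⁺ ⇔ crux;
  not used by the composition).
* `stub_detectionTransfer` — the transfer itself (taken by the lead; LANDED p104480 as
  `Theorems.stub_detectionTransfer`): threefold pairing + top-degree
  injectivity of Gysin morphisms (PROVED: `topGysin_injective` below, the statement of the tree's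
  `Theorems.stub_topGysinInjective` of crux stmt-HodgeConjecture-14301) + vertical detection ⇒ the crux.

Proof of the transfer (`stub_detectionTransfer`; composition `VerticalSupportFourfolds_of`): let `R` be the `ℚ`-space of rational `(2,2)`-classes of
`X` (finite `ℚ`-basis: `smoothProjective_rationalClasses_finiteRatBasis_holds`), `S` the right-hand
side of the crux and `A = R ∩ S`. If `A ≠ R`, a dimension count for the `ℚ`-bilinear cup form
`R × A → H⁸_ℚ ≅ ℚ` (values are rational multiples of one top class) yields `0 ≠ c ∈ R` with
`c ∪ a = 0` for all `a ∈ A`. For a vertical `g : W → X` and a rational `(1,1)`-class `D` on `W`,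
`g_* D` is (up to one non-zero scalar) a rational `(2,2)`-class dying off `pr⁻¹(T)`, so it lies in
`A` and `c ∪ g_* D = 0`; by the projection formula `g_*(g^* c ∪ D) = 0`, by top-degree injectivity
`g^* c ∪ D = 0`, so by `stub_threefoldPairing` `g^* c = 0`; by `stub_verticalDetection` `c = 0` —
contradiction. Hence `R ⊆ S`, which is the crux.
-/

noncomputable section

set_option linter.dupNamespace false

open CategoryTheory
open Literature.AlgebraicGeometry Literature.AlgebraicGeometry.Motives
  Literature.AlgebraicGeometry.HodgeTheory Literature.AlgebraicTopology.SingularHomology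

namespace Summit.HodgeConjecture.HodgeConjecture.Cruxes.VerticalSupportFourfolds.Sketch

/-! ## Stubs -/

/-- STUB `stub_facts` (line `Sketch`; LITERATURE DEBT, no worker): the tree's named fact
`hodgeClasses_cupPairing_nondegenerate` (Brosnan–Fang–Nie–Pearlstein 2009, §6 (6.1): the cup product
is a perfect pairing on Hodge classes) for smooth projective THREEFOLDS — unproved in the tree, reduced
there to the Kähler package `hardLefschetz_hodgeRiemann 3 W` (hard Lefschetz is proved; the residue is
the Hodge–Riemann anisotropy in degree `2` = Hodge index for `(D, D') ↦ D · D' · H`, Voisin I Thm. 6.32).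
Worker verdict (wave 1): `stub-blocked` on exactly this fact. [cite: BrosnanFangNiePearlstein2009, §6 (6.1)]
[cite: VoisinHodgeI2002, Thm. 6.25 and Thm. 6.32] -/
theorem stub_facts : ∀ W : SchemeOver ℂ, hodgeClasses_cupPairing_nondegenerate 3 W := by
  sorry

/-- The threefold pairing in the slice `(k, l) = (2, 1)` (the card's `ThreefoldDivisorDetection`: a
non-zero rational `(2,2)`-class on a smooth projective threefold cups non-trivially with some rational
`(1,1)`-class) from the named fact `stub_facts` — the former stub `stub_threefoldPairing`, RESHAPED after
the worker's `stub-blocked` verdict into (debt `stub_facts`) + (this one-line slice, = the worker's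
`Theorems.stub_threefoldPairing_of_cupPairing`). [cite: BrosnanFangNiePearlstein2009, §6 (6.1)] -/
theorem threefoldPairing_of_facts (h : ∀ W : SchemeOver ℂ, hodgeClasses_cupPairing_nondegenerate 3 W) :
    ∀ ⦃W : Motives.SchemeOver ℂ⦄, Motives.IsSmoothProjective 3 W →
      ∀ (m : ℕ) (hm : 2 * 2 + 2 * 1 = m) (c : complexBetti W (2 * 2)), IsRationalClass c →
        IsOfHodgeType 3 W (2 * 2) 2 2 c → c ≠ 0 →
          ∃ a : complexBetti W (2 * 1), IsRationalClass a ∧ IsOfHodgeType 3 W (2 * 1) 1 1 a ∧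
            cupProduct hm c a ≠ 0 :=
  fun W hW m hm c hc hH hne ↦ h W hW m (by norm_num) hm c hc hH hne

/-- STUB (line `Sketch`, the transfer target C⁺ = `VerticalDetection` of the line card): on a
smooth projective fourfold `X` with a surjection `pr : X ⟶ ℙ³`, a rational `(2,2)`-class which
restricts to zero on every smooth projective threefold `g : W ⟶ X` that is VERTICAL (`pr ∘ g` lands
in a proper Zariski-closed subset of `ℙ³`) is zero. Hodge-conjecture-hard (equivalent to the crux
granted the classical facts; line card `vertical-detection-contact-locus`, §Transfer).
[cite: Arapura2022, Cor. 1.4] [cite: BrosnanFangNiePearlstein2009, §6 (6.1)] -/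
theorem stub_verticalDetection :
    ∀ ⦃X : Motives.SchemeOver ℂ⦄ (pr : X ⟶ Motives.projectiveSpace 3 ℂ),
      Motives.IsSmoothProjective 4 X → Function.Surjective pr.left.base →
        ∀ c : complexBetti X (2 * 2), IsRationalClass c → IsOfHodgeType 4 X (2 * 2) 2 2 c →
          (∀ ⦃W : Motives.SchemeOver ℂ⦄, Motives.IsSmoothProjective 3 W → ∀ g : W ⟶ X,
              (∃ T : Set (Motives.projectiveSpace 3 ℂ).left, IsClosed T ∧ T ≠ Set.univ ∧
                  Set.range (g ≫ pr).left.base ⊆ T) →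
                complexBetti.map g (2 * 2) c = 0) →
            c = 0 := by
  sorry

/-- STUB `stub_transferConverse` (line `Sketch`, the transfer in the CONVERSE direction — crux ⇒ C⁺ —
recording that C⁺ is not stronger than the crux; taken by the lead — LANDED p106042,
`Theorems.stub_transferConverse`; also `Lines/Sketch_equivalence.lean`): granted Deligne's Hodge III Cor. 8.2.8 on the tree's carriers
(`Deligne1974_ker_restrictCompl_eq_iSup_range_complexGysin`) and BFNP (6.1) on fourfolds
(`hodgeClasses_cupPairing_nondegenerate 4 X`), the crux implies vertical detection. Not used by the
composition `VerticalSupportFourfolds_of` (it is the other direction); with `stub_detectionTransfer` it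
certifies C⁺ ⇔ crux. [cite: DeligneHodgeIII1974, Cor. 8.2.8] [cite: BrosnanFangNiePearlstein2009, §6 (6.1)] -/
theorem stub_transferConverse :
    Deligne1974_ker_restrictCompl_eq_iSup_range_complexGysin →
    (∀ X : SchemeOver ℂ, hodgeClasses_cupPairing_nondegenerate 4 X) →
    Summit.HodgeConjecture.HodgeConjecture.Theses.CurveNetMordellWeil.VerticalSupportFourfolds →
    ∀ ⦃X : Motives.SchemeOver ℂ⦄ (pr : X ⟶ Motives.projectiveSpace 3 ℂ),
      Motives.IsSmoothProjective 4 X → Function.Surjective pr.left.base →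
        ∀ c : complexBetti X (2 * 2), IsRationalClass c → IsOfHodgeType 4 X (2 * 2) 2 2 c →
          (∀ ⦃W : Motives.SchemeOver ℂ⦄, Motives.IsSmoothProjective 3 W → ∀ g : W ⟶ X,
              (∃ T : Set (Motives.projectiveSpace 3 ℂ).left, IsClosed T ∧ T ≠ Set.univ ∧
                  Set.range (g ≫ pr).left.base ⊆ T) →
                complexBetti.map g (2 * 2) c = 0) →
            c = 0 := by
  -- LANDED as p106042: `Summit.HodgeConjecture.HodgeConjecture.Theorems.stub_transferConverse`
  -- (Theorems/CurveNetMordellWeilVerticalSupportFourfoldsStubTransferConverse.lean); the local `sorry` is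
  -- replaced by that constant as soon as the farm serves the new module.
  sorry

/-! ## Proved input: top-degree injectivity of Gysin morphisms -/

/-- **The top-degree Gysin push-forward is injective** (proved; the statement of the tree's
`Theorems.stub_topGysinInjective` of crux stmt-HodgeConjecture-14301, re-derived here so that this
skeleton does not depend on that Summits module): for `g : W ⟶ X` of smooth projective varieties of
dimensions `m`, `n`, `g_* : H^{2m}(W(ℂ); ℂ) → H^{2n}(X(ℂ); ℂ)` is the Gysin homomorphism through `H₀`,
which preserves the evaluation on fundamental classes `⟨g_* z, [X(ℂ)]⟩ = ⟨z, [W(ℂ)]⟩`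
(`kroneckerPairing_gysinMap_fundamentalClass`), and `⟨-, [W(ℂ)]⟩` is injective on the top line
(`H_{2m}(W(ℂ); ℂ) = ℂ · [W(ℂ)]`, Kronecker injectivity over a field).
[cite: FultonYoungTableaux1997, Appendix B §B.1 (5)] [cite: HatcherAT2002, Thm. 3.2 and Thm. 3.26] -/
theorem topGysin_injective (μ : OrientationFamily) (hμ : μ.HasPoincareDuality)
    {m n : ℕ} {W X : Motives.SchemeOver ℂ} (hW : Motives.IsSmoothProjective m W)
    (hX : Motives.IsSmoothProjective n X) (g : W ⟶ X) {a b : ℕ} (hab : a + 2 * n = b + 2 * m)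
    (ha : a = 2 * m) : Function.Injective (complexGysin μ hW hX g hab) := by
  -- adapted from Theorems/EndoscopicMiddleDegreeIsotypicMiddleClassesAlgebraicStubTopGysinInjective
  subst ha
  obtain rfl : b = 2 * n := by omega
  rw [complexGysin_eq_gysinMap hW hX g hab (q := 0) (Nat.add_zero _) (Nat.add_zero _)]
  refine (injective_iff_map_eq_zero _).2 fun z hz ↦ ?_
  letI := hW.chartedSpace
  haveI := ComplexPoints.compactSpace_of_isSmoothProjective hW
  haveI := ComplexPoints.t2Space_of_isSmoothProjective hW
  haveI := connectedSpace_complexPoints hW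
  have h := kroneckerPairing_gysinMap_fundamentalClass (μY := μ hW) (hμ hX)
    (AlgPoints.mapContinuous (L := ℂ) g) (Nat.add_zero _) (Nat.add_zero _) z
  rw [hz, map_zero, LinearMap.zero_apply] at h
  apply kroneckerPairing_injective_of_field ℂ (ComplexPoints W) (2 * m)
  rw [map_zero]
  refine LinearMap.ext fun w ↦ ?_
  obtain ⟨r, rfl⟩ := exists_eq_smul_fundamentalClass_of_connectedSpace (μ hW) w
  rw [map_smul, ← h, smul_zero, LinearMap.zero_apply]

/-! ## The transfer stub and the composition -/

/-- STUB (line `Sketch`, the TRANSFER `C⁺ ⇒ crux` of the line card; taken by the lead — LANDED,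
p104480, `Theorems.stub_detectionTransfer`): threefold
pairing (`stub_threefoldPairing`) + top-degree injectivity of Gysin morphisms (the tree's
`topGysin_injective`, proved) + vertical detection (`stub_verticalDetection`) ⇒
every rational `(2,2)`-class of a smooth projective fourfold with a surjection onto `ℙ³` lies in the
span of the VERTICAL rational `(2,2)`-classes (whence `VerticalSupportFourfolds`, whose right-hand side
contains that span), by the dimension count for the rational cup form on the rational
`(2,2)`-classes and the projection formula (module docstring).
[cite: BrosnanFangNiePearlstein2009, §6 (6.1)] [cite: FultonYoungTableaux1997, Appendix B §B.1 (6)] -/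
theorem stub_detectionTransfer :
    (∀ ⦃W : Motives.SchemeOver ℂ⦄, Motives.IsSmoothProjective 3 W →
      ∀ (m : ℕ) (hm : 2 * 2 + 2 * 1 = m) (c : complexBetti W (2 * 2)), IsRationalClass c →
        IsOfHodgeType 3 W (2 * 2) 2 2 c → c ≠ 0 →
          ∃ a : complexBetti W (2 * 1), IsRationalClass a ∧ IsOfHodgeType 3 W (2 * 1) 1 1 a ∧
            cupProduct hm c a ≠ 0) →
    (∀ (μ : OrientationFamily), μ.HasPoincareDuality →
      ∀ ⦃m n : ℕ⦄ ⦃W X : Motives.SchemeOver ℂ⦄ (hW : Motives.IsSmoothProjective m W)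
        (hX : Motives.IsSmoothProjective n X) (g : W ⟶ X) ⦃a b : ℕ⦄
        (hab : a + 2 * n = b + 2 * m), a = 2 * m →
          Function.Injective (complexGysin μ hW hX g hab)) →
    (∀ ⦃X : Motives.SchemeOver ℂ⦄ (pr : X ⟶ Motives.projectiveSpace 3 ℂ),
      Motives.IsSmoothProjective 4 X → Function.Surjective pr.left.base →
        ∀ c : complexBetti X (2 * 2), IsRationalClass c → IsOfHodgeType 4 X (2 * 2) 2 2 c →
          (∀ ⦃W : Motives.SchemeOver ℂ⦄, Motives.IsSmoothProjective 3 W → ∀ g : W ⟶ X,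
              (∃ T : Set (Motives.projectiveSpace 3 ℂ).left, IsClosed T ∧ T ≠ Set.univ ∧
                  Set.range (g ≫ pr).left.base ⊆ T) →
                complexBetti.map g (2 * 2) c = 0) →
            c = 0) →
    ∀ ⦃X : Motives.SchemeOver ℂ⦄ (pr : X ⟶ Motives.projectiveSpace 3 ℂ),
      Motives.IsSmoothProjective 4 X → Function.Surjective pr.left.base →
        Submodule.span ℂ {c : complexBetti X (2 * 2) |
            IsRationalClass c ∧ IsOfHodgeType 4 X (2 * 2) 2 2 c} ≤
          Submodule.span ℂ {c : complexBetti X (2 * 2) |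
            IsRationalClass c ∧ IsOfHodgeType 4 X (2 * 2) 2 2 c ∧
              ∃ T : Set (Motives.projectiveSpace 3 ℂ).left, IsClosed T ∧ T ≠ Set.univ ∧
                complexBetti.restrictCompl X (pr.left.base ⁻¹' T) (2 * 2) c = 0} := by
  -- LANDED as p104480: `Summit.HodgeConjecture.HodgeConjecture.Theorems.stub_detectionTransfer`
  -- (Theorems/CurveNetMordellWeilVerticalSupportFourfoldsStubDetectionTransfer.lean); the local `sorry`
  -- is replaced by that constant as soon as the farm serves the new module.
  sorry

/-- **The line closes the crux modulo its stubs** (composition, kernel-checked): the transfer stub fed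
with the threefold pairing stub, the tree's proved top-degree injectivity of Gysin morphisms
(`topGysin_injective`) and the vertical-detection stub.
[cite: BrosnanFangNiePearlstein2009, §6 (6.1)] -/
theorem VerticalSupportFourfolds_of :
    Summit.HodgeConjecture.HodgeConjecture.Theses.CurveNetMordellWeil.VerticalSupportFourfolds := by
  intro X pr hX hsurj
  exact (stub_detectionTransfer (threefoldPairing_of_facts stub_facts)
    (fun μ hμ _ _ _ _ hW hX g _ _ hab ha ↦ topGysin_injective μ hμ hW hX g hab ha)
    stub_verticalDetection pr hX hsurj).trans le_sup_right

/-! ## The equivalence C⁺ ⇔ crux (documentation; both transfers above) -/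

/-- **C⁺ ⇔ crux, modulo catalogued classical named facts**: granted Deligne's Hodge III Cor. 8.2.8
(`hA`) and BFNP (6.1) on fourfolds (`hP4`) and on threefolds (`hP3`), `VerticalSupportFourfolds` is
EQUIVALENT to vertical detection — `stub_transferConverse` one way, `stub_detectionTransfer` (landed,
p104480) with the proved `topGysin_injective` / `threefoldPairing_of_facts` the other way. This is why the
open stub `stub_verticalDetection` is crux-sized. [cite: BrosnanFangNiePearlstein2009, §6 (6.1)]
[cite: DeligneHodgeIII1974, Cor. 8.2.8] -/
theorem verticalSupportFourfolds_iff_verticalDetection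
    (hA : Deligne1974_ker_restrictCompl_eq_iSup_range_complexGysin)
    (hP4 : ∀ X : SchemeOver ℂ, hodgeClasses_cupPairing_nondegenerate 4 X)
    (hP3 : ∀ W : SchemeOver ℂ, hodgeClasses_cupPairing_nondegenerate 3 W) :
    Summit.HodgeConjecture.HodgeConjecture.Theses.CurveNetMordellWeil.VerticalSupportFourfolds ↔
    ∀ ⦃X : Motives.SchemeOver ℂ⦄ (pr : X ⟶ Motives.projectiveSpace 3 ℂ),
      Motives.IsSmoothProjective 4 X → Function.Surjective pr.left.base →
        ∀ c : complexBetti X (2 * 2), IsRationalClass c → IsOfHodgeType 4 X (2 * 2) 2 2 c →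
          (∀ ⦃W : Motives.SchemeOver ℂ⦄, Motives.IsSmoothProjective 3 W → ∀ g : W ⟶ X,
              (∃ T : Set (Motives.projectiveSpace 3 ℂ).left, IsClosed T ∧ T ≠ Set.univ ∧
                  Set.range (g ≫ pr).left.base ⊆ T) →
                complexBetti.map g (2 * 2) c = 0) →
            c = 0 :=
  ⟨stub_transferConverse hA hP4, fun hDet _ pr hX hsurj ↦
    (stub_detectionTransfer (threefoldPairing_of_facts hP3)
      (fun μ hμ _ _ _ _ hW hX g _ _ hab ha ↦ topGysin_injective μ hμ hW hX g hab ha)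
      hDet pr hX hsurj).trans le_sup_right⟩

end Summit.HodgeConjecture.HodgeConjecture.Cruxes.VerticalSupportFourfolds.Sketch

end
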